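import Summits.Ventures.Crystal3D.Bulk.RotSysDeleteK
import Summits.Ventures.Crystal3D.Bulk.RotSysDeleteF
import HarnessLib

/-!
# Euler characteristic of sub-rotation-systems: deleting an edge never decreases `χ − 2k`;
# hence `χ ≤ 2k` always, and sub-systems of planar systems are planar
# (generic brick (G1), conclusion, of `phase2/LEAN-FACES-DESIGN.md` §5.4)

HONEST FRAMING. Part of the venture `Summits/Ventures/Crystal3D` (cell `pub-crystal3d`, phase 2;
seat typer-bulk-2), PURELY COMBINATORIAL and generic (folklore: "genus is non-negative and does
not increase under edge deletion"). Assembling `Bulk/RotSysDelete*.lean`: for a loopless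
rotation system `(σ, α)` on a finite dart type, an `α`-closed dart set `S` and an edge
`e = {d, α d} ⊆ S`, with `chi2 = 2V − #S + 2F` (twice the Euler characteristic) and `numK`
components:

* (V) `IsRotSys.numV_sdiff`: `numV (S∖e) + [φ d = α d] + [φ (α d) = d] = numV S`;
* **`IsRotSys.chi2_sub_le_sdiff`**: `chi2 S − 4·numK S ≤ chi2 (S∖e) − 4·numK (S∖e)`;
* **`IsRotSys.chi2_sub_le_of_subset`**: for `α`-closed `T ⊆ S`,
  `chi2 S − 4·numK S ≤ chi2 T − 4·numK T` (induction over the edges of `S ∖ T`);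
* **`IsRotSys.chi2_le`**: `chi2 S ≤ 4·numK S` for every `α`-closed `S` (genus `≥ 0`);
* **`IsRotSys.chi2_eq_of_subset`**: if the `α`-closed `S` is PLANAR (`chi2 S = 4·numK S`) then so
  is every `α`-closed `T ⊆ S` — sub-rotation-systems of planar maps are planar.

This is the generic half of the planarity plan for the ORIENTED tight map; the geometric half
((G2) the hull triangulation is a planar rotation system, (G3) the tight rotation is the one it
induces) is NOT here. Nothing here mentions GAP(1.26).
-/

namespace Summit.Ventures.Crystal3D

namespace RotSys

open Equiv Equiv.Perm Finset

variable {D : Type*} [DecidableEq D] [Fintype D]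
variable {σ α : Perm D} {S : Finset D} {d : D}

/-! ## (V) the vertex count -/

open scoped Classical in
/-- **(V)** `numV (S ∖ e) + [φ d = α d] + [φ (α d) = d] = numV S`: a vertex disappears exactly
when its only dart in `S` is removed (`φ d = induce σ S (α d)`, `φ (α d) = induce σ S d`). -/
theorem IsRotSys.numV_sdiff (h : IsRotSys σ α) (hS : IsClosed α S) (hd : d ∈ S) :
    numV σ (S \ {d, α d}) + (if phi σ α S d = α d then 1 else 0) +
        (if phi σ α S (α d) = d then 1 else 0) = numV σ S := by
  have hαd : α d ∈ S := hS d hd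
  have hne : α d ≠ d := h.α_ne d
  -- erase `d`
  have s1 := numV_erase σ (S := S) hd
  have i1 : (∃ y ∈ S, y ≠ d ∧ σ.SameCycle d y) ↔ ¬ phi σ α S (α d) = d := by
    rw [phi_apply, h.α_inv]
    constructor
    · rintro ⟨y, hy, hyd, hc⟩ hfix
      exact hyd ((induce_apply_eq_self_iff σ hd).1 hfix y hy hc)
    · intro hfix
      exact ⟨induce σ S d, induce_apply_mem σ hd, hfix, sameCycle_induce_apply σ S d⟩
  -- erase `α d`
  have hαd' : α d ∈ S.erase d := Finset.mem_erase.2 ⟨hne, hαd⟩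
  have s2 := numV_erase σ (S := S.erase d) hαd'
  have i2 : (∃ y ∈ S.erase d, y ≠ α d ∧ σ.SameCycle (α d) y) ↔ ¬ phi σ α S d = α d := by
    rw [phi_apply]
    constructor
    · rintro ⟨y, hy, hyd, hc⟩ hfix
      exact hyd ((induce_apply_eq_self_iff σ hαd).1 hfix y (Finset.mem_erase.1 hy).2 hc)
    · intro hfix
      refine ⟨induce σ S (α d), Finset.mem_erase.2 ⟨?_, induce_apply_mem σ hαd⟩, hfix,
        sameCycle_induce_apply σ S (α d)⟩
      intro hbad
      have := sameCycle_induce_apply σ S (α d)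
      rw [hbad] at this
      have hl := h.loopless (α d)
      rw [h.α_inv] at hl
      exact hl this
  rw [sdiff_pair_eq_erase_erase]
  by_cases ha : phi σ α S d = α d <;> by_cases hb : phi σ α S (α d) = d
  · rw [if_neg (fun hh => (i1.1 hh) hb)] at s1
    rw [if_neg (fun hh => (i2.1 hh) ha)] at s2
    rw [if_pos ha, if_pos hb]; omega
  · rw [if_pos (i1.2 hb)] at s1
    rw [if_neg (fun hh => (i2.1 hh) ha)] at s2
    rw [if_pos ha, if_neg hb]; omega
  · rw [if_neg (fun hh => (i1.1 hh) hb)] at s1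
    rw [if_pos (i2.2 ha)] at s2
    rw [if_neg ha, if_pos hb]; omega
  · rw [if_pos (i1.2 hb)] at s1
    rw [if_pos (i2.2 ha)] at s2
    rw [if_neg ha, if_neg hb]; omega

omit [Fintype D] in
/-- The dart count: `#(S ∖ e) + 2 = #S`. -/
theorem IsRotSys.card_sdiff (h : IsRotSys σ α) (hS : IsClosed α S) (hd : d ∈ S) :
    (S \ {d, α d}).card + 2 = S.card := by
  have hsub : ({d, α d} : Finset D) ⊆ S := by
    intro x hx
    rw [Finset.mem_insert, Finset.mem_singleton] at hx
    rcases hx with rfl | rfl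
    · exact hd
    · exact hS _ hd
  rw [Finset.card_sdiff_of_subset hsub, Finset.card_pair (h.α_ne d).symm]
  have : 2 ≤ S.card := by
    rw [← Finset.card_pair (h.α_ne d).symm]; exact Finset.card_le_card hsub
  omega

/-! ## (K) in the three regimes -/

omit [Fintype D] in
/-- The surviving darts at the vertex of `d` are `S`-connected to `d`; so if one exists, the
component of `d` is not the bare edge. -/
theorem exists_conn_of_not_alone (hS : IsClosed α S) (hd : d ∈ S) {v : D} (hv : v = d ∨ v = α d)
    {w : D} (hw : w ∈ S \ {d, α d}) (hc : σ.SameCycle v w) :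
    ∃ y ∈ S, y ≠ d ∧ y ≠ α d ∧ conn σ α S d y := by
  rw [Finset.mem_sdiff, Finset.mem_insert, Finset.mem_singleton, not_or] at hw
  refine ⟨w, hw.1, hw.2.1, hw.2.2, ?_⟩
  rcases hv with rfl | rfl
  · exact conn_of_sameCycle hd hw.1 hc
  · exact conn_trans (conn_alpha hS hd) (conn_of_sameCycle (hS _ hd) hw.1 hc)

/-- MERGE: the two ends stay connected in `S ∖ e` (one face of `S ∖ e` passes through both), so
`numK (S ∖ e) = numK S`. -/
theorem IsRotSys.numK_sdiff_merge (h : IsRotSys σ α) (hS : IsClosed α S) (hd : d ∈ S)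
    (hdiff : ¬ (phi σ α S).SameCycle d (α d)) :
    numK σ α (S \ {d, α d}) = numK σ α S := by
  obtain ⟨-, ha, hb⟩ := h.numF_sdiff_merge hS hd hdiff
  set S' := S \ {d, α d} with hS'def
  have hS' : IsClosed α S' := isClosed_sdiff_pair h hS d
  have hαd : α d ∈ S := hS d hd
  have mem_S' : ∀ z, z ∈ S' ↔ z ∈ S ∧ z ≠ d ∧ z ≠ α d := by
    intro z
    rw [hS'def, Finset.mem_sdiff, Finset.mem_insert, Finset.mem_singleton, not_or]
  -- the two special darts: `p := φ (α d)` at the vertex of `d`, `q := φ d` at the vertex of `α d`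
  have hp : phi σ α S (α d) ∈ S' := by
    rw [mem_S', phi_apply, h.α_inv]
    refine ⟨induce_apply_mem σ hd, ?_, h.induce_ne_alpha S d⟩
    rw [phi_apply, h.α_inv] at hb; exact hb
  have hq : phi σ α S d ∈ S' := by
    rw [mem_S', phi_apply]
    refine ⟨induce_apply_mem σ hαd, ?_, ?_⟩
    · have := h.induce_ne_alpha S (α d); rwa [h.α_inv] at this
    · rw [phi_apply] at ha; exact ha
  have hpd : σ.SameCycle d (phi σ α S (α d)) := by
    rw [phi_apply, h.α_inv]; exact sameCycle_induce_apply σ S d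
  have hqd : σ.SameCycle (α d) (phi σ α S d) := by
    rw [phi_apply]; exact sameCycle_induce_apply σ S (α d)
  -- they lie on one `ν`-cycle, hence on one face of `S'`, hence are `S'`-connected
  have hν : (nu σ α S d).SameCycle (phi σ α S d) (phi σ α S (α d)) := by
    have h1 : (nu σ α S d).SameCycle d (α d) :=
      (sameCycle_swap_mul_iff_merge (phi σ α S) hdiff d (α d)).2
        (Or.inr ⟨Or.inl (SameCycle.refl _ _), Or.inr (SameCycle.refl _ _)⟩)
    have h2 : (nu σ α S d).SameCycle d (phi σ α S d) := by
      refine ⟨1, ?_⟩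
      rw [zpow_one, nu_apply, swap_apply_of_ne_of_ne (fun he => h.phi_ne_self S d he) ha]
    have h3 : (nu σ α S d).SameCycle (α d) (phi σ α S (α d)) := by
      refine ⟨1, ?_⟩
      rw [zpow_one, nu_apply, swap_apply_of_ne_of_ne hb (fun he => h.phi_ne_self S (α d) he)]
    exact h2.symm.trans (h1.trans h3)
  have hφ' : (phi σ α S').SameCycle (phi σ α S d) (phi σ α S (α d)) := by
    rw [sameCycle_iff_of_eqOn (fun z hz => h.phi_sdiff_eq_induce_nu hS hd hz)
      (fun z hz => phi_apply_mem hS' hz) (fun z hz => induce_apply_mem _ hz) hq]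
    exact (sameCycle_induce_iff _ hq hp).2 hν
  have hconn : conn σ α S' (phi σ α S d) (phi σ α S (α d)) := conn_of_sameCycle_phi hS' hq hφ'
  -- every near dart is `S'`-connected to `p` or `q`
  have near : ∀ w ∈ S', (σ.SameCycle d w ∨ σ.SameCycle (α d) w) →
      conn σ α S' w (phi σ α S (α d)) := by
    intro w hw hnw
    rcases hnw with h1 | h1
    · exact conn_of_sameCycle hw hp (h1.symm.trans hpd)
    · exact conn_trans (conn_of_sameCycle hw hq (h1.symm.trans hqd)) hconn
  apply le_antisymm
  · calc numK σ α S' ≤ numClasses (conn σ α S) S' :=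
          h.numK_sdiff_le_of_near_conn hS hd fun w hw w' hw' hn hn' =>
            conn_trans (near w hw hn) (conn_symm (near w' hw' hn'))
      _ ≤ numK σ α S := by rw [← h.numClasses_conn_sdiff hS hd]; exact Nat.le_add_right _ _
  · have := h.numK_le_numK_sdiff_add hS hd
    rwa [if_pos (exists_conn_of_not_alone hS hd (Or.inl rfl) hp hpd), add_zero] at this

/-- PENDANT or ISOLATED: if an end-vertex is alone, no split: `numK (S∖e) ≤ #conn_S-classes`. -/
theorem IsRotSys.numK_sdiff_le_of_alone (h : IsRotSys σ α) (hS : IsClosed α S) (hd : d ∈ S)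
    (halone : phi σ α S d = α d ∨ phi σ α S (α d) = d) :
    numK σ α (S \ {d, α d}) ≤ numClasses (conn σ α S) (S \ {d, α d}) := by
  have hαd : α d ∈ S := hS d hd
  -- which vertex is empty in `S'`
  have empty : ∃ v, (v = d ∨ v = α d) ∧ ∀ w ∈ S \ {d, α d}, ¬ σ.SameCycle v w := by
    rcases halone with ha | hb
    · -- `induce σ S (α d) = α d`: `α d` alone
      refine ⟨α d, Or.inr rfl, fun w hw hc => ?_⟩
      rw [Finset.mem_sdiff, Finset.mem_insert, Finset.mem_singleton, not_or] at hw
      rw [phi_apply] at ha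
      exact hw.2.2 ((induce_apply_eq_self_iff σ hαd).1 ha w hw.1 hc)
    · refine ⟨d, Or.inl rfl, fun w hw hc => ?_⟩
      rw [Finset.mem_sdiff, Finset.mem_insert, Finset.mem_singleton, not_or] at hw
      rw [phi_apply, h.α_inv] at hb
      exact hw.2.1 ((induce_apply_eq_self_iff σ hd).1 hb w hw.1 hc)
  obtain ⟨v, hv, hempty⟩ := empty
  refine h.numK_sdiff_le_of_near_conn hS hd fun w hw w' hw' hn hn' => ?_
  -- both near darts are at the OTHER vertex, hence in one `σ`-cycle
  have key : ∀ u ∈ S \ {d, α d}, (σ.SameCycle d u ∨ σ.SameCycle (α d) u) →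
      σ.SameCycle (if v = d then α d else d) u := by
    intro u hu hnu
    rcases hv with rfl | rfl
    · rw [if_pos rfl]
      rcases hnu with h1 | h1
      · exact absurd h1 (hempty u hu)
      · exact h1
    · rw [if_neg (h.α_ne d)]
      rcases hnu with h1 | h1
      · exact h1
      · exact absurd h1 (hempty u hu)
  exact conn_of_sameCycle hw hw' ((key w hw hn).symm.trans (key w' hw' hn'))

/-- ISOLATED: if both end-vertices are alone, the component of `d` is the bare edge. -/
theorem IsRotSys.not_exists_conn_of_isolated (h : IsRotSys σ α) (hS : IsClosed α S) (hd : d ∈ S)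
    (ha : phi σ α S d = α d) (hb : phi σ α S (α d) = d) :
    ¬ ∃ y ∈ S, y ≠ d ∧ y ≠ α d ∧ conn σ α S d y := by
  have hαd : α d ∈ S := hS d hd
  rw [phi_apply] at ha
  rw [phi_apply, h.α_inv] at hb
  have alone_d : ∀ y ∈ S, σ.SameCycle d y → y = d := (induce_apply_eq_self_iff σ hd).1 hb
  have alone_a : ∀ y ∈ S, σ.SameCycle (α d) y → y = α d := (induce_apply_eq_self_iff σ hαd).1 ha
  -- the set `e` is closed under adjacency
  have closed : ∀ a b, conn σ α S a b → ((a = d ∨ a = α d) ↔ (b = d ∨ b = α d)) := by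
    intro a b hab
    induction hab with
    | rel a b hab =>
      obtain ⟨haS, hbS, hrel⟩ := hab
      constructor
      · rintro (rfl | rfl)
        · rcases hrel with hc | he
          · exact Or.inl (alone_d b hbS hc)
          · exact Or.inr he
        · rcases hrel with hc | he
          · exact Or.inr (alone_a b hbS hc)
          · rw [h.α_inv] at he; exact Or.inl he
      · rintro (rfl | rfl)
        · rcases hrel with hc | he
          · exact Or.inl (alone_d a haS hc.symm)
          · right; rw [he, h.α_inv]
        · rcases hrel with hc | he
          · exact Or.inr (alone_a a haS hc.symm)
          · left; exact (α.injective he).symm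
    | refl a => exact Iff.rfl
    | symm a b _ ih => exact ih.symm
    | trans a b c _ _ ih1 ih2 => exact ih1.trans ih2
  rintro ⟨y, -, hyd, hyα, hc⟩
  rcases (closed d y hc).1 (Or.inl rfl) with h1 | h1
  · exact hyd h1
  · exact hyα h1

/-! ## The deletion inequality and its consequences -/

/-- **Deleting an edge never decreases `χ − 2k`**:
`chi2 S − 4·numK S ≤ chi2 (S ∖ {d, α d}) − 4·numK (S ∖ {d, α d})`. -/
theorem IsRotSys.chi2_sub_le_sdiff (h : IsRotSys σ α) (hS : IsClosed α S) (hd : d ∈ S) :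
    chi2 σ α S - 4 * (numK σ α S : ℤ) ≤
      chi2 σ α (S \ {d, α d}) - 4 * (numK σ α (S \ {d, α d}) : ℤ) := by
  have hV := h.numV_sdiff hS hd
  have hE := h.card_sdiff hS hd
  have hKlow := h.numK_le_numK_sdiff_add hS hd
  have hKsdiff := h.numClasses_conn_sdiff hS hd
  unfold chi2
  by_cases hdiff : (phi σ α S).SameCycle d (α d)
  · -- SPLIT
    have hF := h.numF_sdiff_split hS hd hdiff
    by_cases hal : phi σ α S d = α d ∨ phi σ α S (α d) = d
    · -- pendant or isolated: no split in `k`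
      have hK1 := h.numK_sdiff_le_of_alone hS hd hal
      by_cases hiso : phi σ α S d = α d ∧ phi σ α S (α d) = d
      · have hind := h.not_exists_conn_of_isolated hS hd hiso.1 hiso.2
        rw [if_neg hind] at hKlow hKsdiff
        rw [if_pos hiso.1, if_pos hiso.2] at hV hF
        omega
      · -- exactly one pendant end: the other vertex keeps a dart, component survives
        have hind : ∃ y ∈ S, y ≠ d ∧ y ≠ α d ∧ conn σ α S d y := by
          rcases hal with ha | hb
          · have hb : ¬ phi σ α S (α d) = d := fun hb => hiso ⟨ha, hb⟩
            -- `p := φ (α d)` survives at the vertex of `d`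
            have hp : phi σ α S (α d) ∈ S \ {d, α d} := by
              rw [Finset.mem_sdiff, Finset.mem_insert, Finset.mem_singleton, not_or, phi_apply,
                h.α_inv]
              refine ⟨induce_apply_mem σ hd, ?_, h.induce_ne_alpha S d⟩
              rw [phi_apply, h.α_inv] at hb; exact hb
            refine exists_conn_of_not_alone hS hd (Or.inl rfl) hp ?_
            rw [phi_apply, h.α_inv]; exact sameCycle_induce_apply σ S d
          · have ha : ¬ phi σ α S d = α d := fun ha => hiso ⟨ha, hb⟩
            have hq : phi σ α S d ∈ S \ {d, α d} := by
              rw [Finset.mem_sdiff, Finset.mem_insert, Finset.mem_singleton, not_or, phi_apply]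
              refine ⟨induce_apply_mem σ (hS d hd), ?_, ?_⟩
              · have := h.induce_ne_alpha S (α d); rwa [h.α_inv] at this
              · rw [phi_apply] at ha; exact ha
            refine exists_conn_of_not_alone hS hd (Or.inr rfl) hq ?_
            rw [phi_apply]; exact sameCycle_induce_apply σ S (α d)
        rw [if_pos hind] at hKlow hKsdiff
        rcases hal with ha | hb
        · have hb : ¬ phi σ α S (α d) = d := fun hb => hiso ⟨ha, hb⟩
          rw [if_pos ha, if_neg hb] at hV hF
          omega
        · have ha : ¬ phi σ α S d = α d := fun ha => hiso ⟨ha, hb⟩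
          rw [if_neg ha, if_pos hb] at hV hF
          omega
    · -- genuine split: `k` grows by at most one
      rw [not_or] at hal
      rw [if_neg hal.1, if_neg hal.2] at hV hF
      have hK := h.numK_sdiff_le_numK_succ hS hd
      omega
  · -- MERGE
    obtain ⟨hF, ha, hb⟩ := h.numF_sdiff_merge hS hd hdiff
    have hK := h.numK_sdiff_merge hS hd hdiff
    rw [if_neg ha, if_neg hb] at hV
    omega

/-- **Monotonicity along inclusions**: for `α`-closed `T ⊆ S`,
`chi2 S − 4·numK S ≤ chi2 T − 4·numK T`. -/
theorem IsRotSys.chi2_sub_le_of_subset (h : IsRotSys σ α) :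
    ∀ (n : ℕ) (S T : Finset D), (S \ T).card = n → IsClosed α S → IsClosed α T → T ⊆ S →
      chi2 σ α S - 4 * (numK σ α S : ℤ) ≤ chi2 σ α T - 4 * (numK σ α T : ℤ) := by
  intro n
  induction n using Nat.strong_induction_on with
  | _ n ih =>
    intro S T hn hS hT hTS
    by_cases hST : S \ T = ∅
    · have : S = T := Finset.Subset.antisymm (Finset.sdiff_eq_empty_iff_subset.1 hST) hTS
      rw [this]
    · obtain ⟨d, hd⟩ := Finset.nonempty_iff_ne_empty.2 hST
      rw [Finset.mem_sdiff] at hd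
      -- delete the edge of `d`: still contains `T`
      have hαd : α d ∉ T := fun hmem => hd.2 (by have := hT _ hmem; rwa [h.α_inv] at this)
      have hTS' : T ⊆ S \ {d, α d} := by
        intro x hx
        rw [Finset.mem_sdiff, Finset.mem_insert, Finset.mem_singleton, not_or]
        exact ⟨hTS hx, fun e => hd.2 (e ▸ hx), fun e => hαd (e ▸ hx)⟩
      have hlt : ((S \ {d, α d}) \ T).card < n := by
        rw [← hn]
        apply Finset.card_lt_card
        refine ⟨fun x hx => ?_, fun hsub => ?_⟩
        · rw [Finset.mem_sdiff] at hx ⊢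
          exact ⟨Finset.sdiff_subset hx.1, hx.2⟩
        · have : d ∈ (S \ {d, α d}) \ T := hsub (Finset.mem_sdiff.2 hd)
          rw [Finset.mem_sdiff, Finset.mem_sdiff, Finset.mem_insert] at this
          exact this.1.2 (Or.inl rfl)
      exact (h.chi2_sub_le_sdiff hS hd.1).trans
        (ih _ hlt (S \ {d, α d}) T rfl (isClosed_sdiff_pair h hS d) hT hTS')

/-- **Genus is non-negative**: `chi2 S ≤ 4·numK S` for every `α`-closed `S` (i.e.
`V − E + F ≤ 2k`). -/
theorem IsRotSys.chi2_le (h : IsRotSys σ α) (hS : IsClosed α S) :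
    chi2 σ α S ≤ 4 * (numK σ α S : ℤ) := by
  have := h.chi2_sub_le_of_subset _ S ∅ rfl hS (fun _ hx => by simp at hx) (Finset.empty_subset _)
  rw [chi2_empty, numK_empty] at this
  omega

/-- **Sub-rotation-systems of planar rotation systems are planar**: if `chi2 S = 4·numK S`
(`V − E + F = 2k`, every component has genus `0`) then the same holds for every `α`-closed
`T ⊆ S` with its induced rotation. -/
theorem IsRotSys.chi2_eq_of_subset (h : IsRotSys σ α) (hS : IsClosed α S) {T : Finset D}
    (hT : IsClosed α T) (hTS : T ⊆ S) (hplanar : chi2 σ α S = 4 * (numK σ α S : ℤ)) :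
    chi2 σ α T = 4 * (numK σ α T : ℤ) := by
  have h1 := h.chi2_sub_le_of_subset _ S T rfl hS hT hTS
  have h2 := h.chi2_le hT
  omega

end RotSys

end Summit.Ventures.Crystal3D
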